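import Summits.QuantumFields.YangMills.Theorems.UnitScaleTiltProp7OneFormKatoForm
import Summits.QuantumFields.YangMills.Theorems.UnitScaleTiltProp7KatoBootstrapMember
import Summits.QuantumFields.YangMills.Theorems.UnitScaleTiltProp7RieszTauFrobNormT3
import HarnessLib

/-!
# Route `UnitScaleTilt`, crux K1 «MinimiserStabilityRegPr» (stmt-QuantumFields-19200), EX face S45 — (L3′b)-VALUE, ONE-FORM STOREY, FILE O2:
# **THE KATO BOOTSTRAP (ENERGY → SUP) FOR THE MEMBER's ONE-FORM OPERATOR `Δ_a = Δx + D R_S D* + Q*aQ` ON THE BOND GRAPH** — print's «|G(U)f| ≤ B₀|f|»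
# ([Balaban1985BackgroundPropagators] Thm 3.12 ∕ the (3.42)-analogue for the vector propagators `G₀`, `G`, p. 421) AT THE T³ MEMBER, modulo the displayed pointwise letters
# (X) `‖((Δx − Δ^η)u)(p)‖`, (D) `‖(D(1 − R_S)D*u)(p)‖`, (Q) `‖(aQ_k†Q_k u)(p)‖` and the energy letter (E)

Cell `ym3-torus` (HUMAN RULING D-0037; rung R3 = SU(2) YM₃ on T³ — NOT d = 4, NOT infinite volume, NOT a mass gap, NOT Clay).  Chair seat ★`ym-ust-19200-p1` g26, own pen
(VALUE book; px5 g12 LOCATE-ONEFORM-VALUE e62c4fbc O2; O1 = px5 g12 ✓`Prop7OneFormKatoForm`).  THEOREMS ONLY (0 `def`, 0 `sorry`, default heartbeats);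
`--supports stmt-QuantumFields-19200 --as helper`; count-neutral.

WHY.  O1 (px5 g12 ✓`Prop7OneFormKatoForm.symm_laplaceA_toL2_apply`) reads the member's one-form operator `Δ_a(U₀) = Δx + D_{U₀}R_S D*_{U₀} + aQ_k†Q_k` back on the bonds as
`η⁻²Δ¹_{U₀}` (the componentwise covariant Laplacian, [Balaban1985Variational] (135)) plus the displayed remainder `η⁻²(Δ′₁ − 𝒦) + (Δx − Δ^η) − D(1 − R_S)D* + aQ_k†Q_k`, whose local part
is `≤ 32·ε₀·sup|X|` on `RegPr ε₀ U₀` (✓`norm_local_remainder_le_of_regPr`).  THIS FILE puts V1's Kato graph ON THE BONDS (`ι := Bond`, `J := Fin 3 ⊕ Fin 3`, neighbours `(y ∓ e_ν, μ)`,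
transporters `R(U₀)⁻¹`, `R(U₀)` — Frobenius isometries), shows its Kato sum IS `η⁻²Δ¹_{U₀}` (lit ✓`B11Eq135Weitzenbock.vecLap` via ★px16 ✓`covLapFormT_one_eq`), proves the flat scalar
letter (FS) on the bond graph from lit ✓`B5Eq129FreeResolventZoneSumSites.hFS_tsite_diag` component by component, and runs lit ✓`B9Eq342SupNormBootstrapLinf.norm_le_of_kato_bootstrap_linf`
(Kato domination twice, [DodziukMathai2006]; NO random walk, NO window) with the local part in the `p_∞` slot and (X)(D)(Q) in the `R` slot.
WHAT IS PROVED (ns `Summit.QuantumFields.YangMills.Theorems.Prop7OneFormKatoBootstrap`; member `F`, `n ≤ K`, `ℓ = L^{K−n} = η⁻¹`; `A := formComp (toL2⁻¹ v)`, `x := siteEquiv⁻¹ y`).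
* §1 dictionary: `equiv_apply_eq` (`v(y,μ) = frobEquiv⁻¹ A_μ(x)`), `frobEquiv_adBg`∕`frobEquiv_adBgInv` (the transporters are lit's `R(U)`, `R(U)⁻¹`),
  ★★`kato_sum_eq_vecLap` (the bond-graph Kato sum with weights `t²` `= frobEquiv⁻¹(t²·(vecLap A)_μ(x))`, via lit ✓`covDstar_covD`), `norm_eq_sqrt_sum_bond`,
  ★`hFS_bond` ((FS) on bonds: three decoupled copies of the site graph; `Σ_y ≤ Σ_{(y,ν)}`).
* §2 ★★★ `norm_apply_le_of_kato_oneForm` — FOR EVERY `U₀ ∈ RegPr F n K ε₀` with `64√2·ε₀ < 1`, EVERY slot `Δx`, every `u f` with `Δ_a(U₀)u = f`, from the displayed numbers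
  `‖f(p)‖ ≤ F_b`, (X) `‖((Δx U₀ − Δ^η)u)(p)‖ ≤ R_X`, (D) `‖(D(1−R_S)D*u)(p)‖ ≤ R_D`, (Q) `‖(Q_k†(aQ_k u))(p)‖ ≤ R_Q` (fibre norms of `W₂`):
  `‖u(p)‖ ≤ (2(F_b + (R_Q + R_D + R_X)) + √(3³∕(c₀ℓ³))·‖u‖) ∕ (1 − 2·(32√2·ε₀))` at EVERY bond — print's (3.39)-type sup bound for the CURVED one-form operator.
* §3 ★★ `norm_apply_le_of_kato_oneForm_block` — with (E) `‖u‖ ≤ C_E‖f‖`, `R_• ≤ p_•‖u‖`, `f` vanishing off a finite set `S` of bonds and `200·ε₀ ≤ 1`: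
  `‖u(p)‖ ≤ 2·(2 + (2(p_Q + p_D + p_X) + √(3³∕(c₀ℓ³)))·C_E·√(c₀·#S))·F_b` — one block of bonds (`#S = 3ℓ³`): scalar part `9`, K-FREE; ★★ `…_block_DeltaEta` — the slot of record
  `Δx := DeltaEtaSlot` (print's `G₀`), where (X) vanishes identically.
LETTERS LEFT DISPLAYED (for the knit): (E) = coercivity of `Δ_a` (the LOD target `hT` ✓`Prop7LODTargetExists.hT_exists` under Lift, `C_E = 1∕γ_LOD`); (D) = the pointwise kernel of
`D(1 − R_S)D*` (V6 ✓`Prop7ComplementaryProjectorGradientKernel` modulo `hDcol` = (G1-3b)); (Q) = the bond spike row of `Q_k†Q_k` (V2's pattern); (X) = `0` at `DeltaEtaSlot`, the slot's own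
letter at `DeltaOnePJ`∕`DeltaPiSlotP`.
HONEST SCOPE.  A composition of lit engines at O1's letters; CONDITIONAL on (E)(X)(D)(Q)(supp); nothing of the ten EX rows, `hT`, Thm 3.12 for print's `G`∕`H`, EX or the crux is proved here.

References: T. Bałaban, CMP **99** (1985) 389–434 [Balaban1985BackgroundPropagators] ((3.3)∕(3.8) pp.391–392, (3.11) p.392, (3.26) p.395, (3.39)∕Thm 3.1 (3.42) p.397, Thm 3.12 p.422,
p.421); CMP **102** (1985) 277–309 [Balaban1985Variational] ((134)–(136) p.298); CMP **95** (1984) 17–40 [Balaban1984PropagatorsI] ((1.29) p.23); J. Dodziuk, V. Mathai, Contemp. Math.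
**398** (2006) [DodziukMathai2006] (§1, Lemma 1.1).
-/

set_option autoImplicit false

noncomputable section

open scoped Matrix.Norms.L2Operator BigOperators InnerProductSpace ComplexConjugate

namespace Summit.QuantumFields.YangMills.Theorems.Prop7OneFormKatoBootstrap

open Literature.MathematicalPhysics.QuantumFieldTheory.Balaban1983to89
open Literature.MathematicalPhysics.QuantumFieldTheory.Balaban1983to89.T3ContinuumYM3Torus
open Literature.MathematicalPhysics.QuantumFieldTheory.Balaban1983to89.T3PrintedRegularMinimiser (RegPr)
open T3SectALandauChart (formComp bgUnits covLapFormT eta eta_pos)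
open B4Sect5Torus (TSite)
open B9SectCLatticeCarrier (Bond shift unshift)
open B9Eq311L2Pairing (WL2)
open B9TorusCalculus (torusT torusT_apply torusT_symm_apply torusT_comm)
open B9Eq39Adjoint (R R_one)
open B9Eq310Hermitian (deltaPrimeOp)
open B11Eq135Weitzenbock (vecLap curvOp vecLap_def covDstar_covD)
open B11Eq103H1Complex (SiteL2K BondL2K)
open B9Eq342SupNormBootstrap (norm_le_of_kato_bootstrap)
open B5Eq129FreeResolventZoneSumSites (hFS_tsite_diag)
open Summit.QuantumFields.YangMills.Theorems.Prop7SectET3Transport (periodsT3 siteEquiv bondEquiv bgOfCfg siteEquiv_symm_shift bondEquiv_apply)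
open Summit.QuantumFields.YangMills.Theorems.Prop7SectET3HilbertLetters (W₂ frobEquiv adW adBg adBgInv toL2 DL2 DstarL2 frobEquiv_adW toL2_symm_apply)
open Summit.QuantumFields.YangMills.Theorems.Prop7SectET3WilsonHessian (DeltaEta DeltaEtaSlot DeltaEtaSlot_apply)
open Summit.QuantumFields.YangMills.Theorems.Prop7SectET3GaugeProjector (RS)
open Summit.QuantumFields.YangMills.Theorems.Prop7SectET3CurvedPropagators (laplaceA Qk)
open Summit.QuantumFields.YangMills.Theorems.Prop7SecondOrderDict (covLapFormT_one_eq)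
open Summit.QuantumFields.YangMills.Theorems.Prop7RieszTauFrobNorm (norm_frobEquiv_le norm_frobEquiv_symm_le)
open Summit.QuantumFields.YangMills.Theorems.Prop7KatoBootstrapMember (norm_adBg_eq norm_adBgInv_eq eta_inv_le_periods)
open Summit.QuantumFields.YangMills.Theorems.Prop7OneFormKatoForm (symm_laplaceA_toL2_apply norm_local_remainder_le_of_regPr)
open Summit.QuantumFields.YangMills.Theorems.Prop7LandauDict (siteEquiv_symm_unshift)

variable {F : T3Family} {n K : ℕ} {c₀ : ℝ}

/-! ## §1 The bond graph: dictionary, Kato sum, `L²` norm, flat scalar letter -/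

/-- The `L²` vector field at lit's bond `(y,μ)` IS the route one-form `toL2⁻¹ v` at `⟨siteEquiv⁻¹ y, μ⟩`, read in `W₂`: `v(y,μ) = frobEquiv⁻¹ (A_μ(x))`, `A = formComp (toL2⁻¹ v)`.
[cite: Balaban1985BackgroundPropagators, (3.11) p.392] -/
theorem equiv_apply_eq (v : BondL2K ℂ 3 (periodsT3 F K) c₀ W₂) (y : TSite 3 (periodsT3 F K)) (μ : Fin 3) :
    WL2.equiv ℂ _ W₂ v (y, μ) = frobEquiv.symm (formComp ((toL2 F K c₀).symm v) μ ((siteEquiv F K).symm y)) := by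
  show _ = frobEquiv.symm (((toL2 F K c₀).symm v) ⟨(siteEquiv F K).symm y, μ⟩)
  rw [toL2_symm_apply, bondEquiv_apply, Equiv.apply_symm_apply, LinearEquiv.symm_apply_apply]
  rfl

/-- The member's transporter `adBg U₀ (y,ν)` IS lit's `R(U₀(x,ν))` read through `frobEquiv`. [cite: Balaban1985BackgroundPropagators, (3.3) p.391] -/
theorem frobEquiv_adBg (U₀ : GaugeField (F.P K) 0 (Matrix.specialUnitaryGroup (Fin 2) ℂ)) (y : TSite 3 (periodsT3 F K)) (ν : Fin 3) (w : W₂) :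
    frobEquiv (adBg F K U₀ (y, ν) w) = R (bgUnits F K U₀ ⟨(siteEquiv F K).symm y, ν⟩) (frobEquiv w) := by
  rw [adBg, frobEquiv_adW]; rfl

/-- The member's inverse transporter `adBgInv U₀ (y,ν)` IS lit's `R(U₀(x,ν)⁻¹)`. [cite: Balaban1985BackgroundPropagators, (3.5) p.391, (3.8) p.392] -/
theorem frobEquiv_adBgInv (U₀ : GaugeField (F.P K) 0 (Matrix.specialUnitaryGroup (Fin 2) ℂ)) (y : TSite 3 (periodsT3 F K)) (ν : Fin 3) (w : W₂) :
    frobEquiv (adBgInv F K U₀ (y, ν) w) = R (bgUnits F K U₀ ⟨(siteEquiv F K).symm y, ν⟩)⁻¹ (frobEquiv w) := by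
  rw [adBgInv, frobEquiv_adW]; rfl

/-- ★★ **THE KATO SUM ON BONDS IS `vecLap`**: with neighbours `(y ∓ e_ν, μ)`, transporters `R(U₀(y−e_ν,ν))⁻¹`, `R(U₀(y,ν))` and weights `t²`,
`Σ_{j : Fin 3 ⊕ Fin 3} t²•(v(y,μ) − T_j v(nbr_j(y,μ))) = frobEquiv⁻¹ (t² · (Δ_{U₀}A)_μ(x))` — lit's `vecLap` ([B11] (135): `Δ_{U₀}` applied to each component `A_μ`).
[cite: Balaban1985Variational, (135) p.298; Balaban1985BackgroundPropagators, (3.23) p.394] -/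
theorem kato_sum_eq_vecLap (U₀ : GaugeField (F.P K) 0 (Matrix.specialUnitaryGroup (Fin 2) ℂ)) (v : BondL2K ℂ 3 (periodsT3 F K) c₀ W₂) (t : ℝ)
    (y : TSite 3 (periodsT3 F K)) (μ : Fin 3) :
    ∑ j : Fin 3 ⊕ Fin 3, ((t ^ 2 : ℝ) : ℂ) • (WL2.equiv ℂ _ W₂ v (y, μ) -
        Sum.elim (fun ν => adBgInv F K U₀ (unshift ν y, ν)) (fun ν => adBg F K U₀ (y, ν)) j
          (WL2.equiv ℂ _ W₂ v (Sum.elim (fun ν => unshift ν y) (fun ν => shift ν y) j, μ)))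
      = frobEquiv.symm (((t ^ 2 : ℝ) : ℂ) •
          vecLap (torusT (F.P K) 0) (fun ν x => bgUnits F K U₀ ⟨x, ν⟩) (formComp ((toL2 F K c₀).symm v)) μ ((siteEquiv F K).symm y)) := by
  apply frobEquiv.injective
  rw [LinearEquiv.apply_symm_apply, map_sum, vecLap_def, Finset.smul_sum, Fintype.sum_sum_type, ← Finset.sum_add_distrib]
  refine Finset.sum_congr rfl fun ν _ => ?_
  simp only [Sum.elim_inl, Sum.elim_inr, map_smul, map_sub, frobEquiv_adBg, frobEquiv_adBgInv, equiv_apply_eq, LinearEquiv.apply_symm_apply,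
    siteEquiv_symm_shift, siteEquiv_symm_unshift]
  rw [covDstar_covD _ _ torusT_comm, inv_mul_cancel, R_one, Equiv.symm_apply_apply, torusT_apply, torusT_symm_apply, ← smul_add]
  congr 1
  abel

/-- Bookkeeping: the weighted `L²` norm (3.11) of a vector field IS `√(Σ_p c₀‖v(p)‖²)`. [cite: Balaban1985BackgroundPropagators, (3.11) p.392] -/
theorem norm_eq_sqrt_sum_bond [Fact (0 < c₀)] (v : BondL2K ℂ 3 (periodsT3 F K) c₀ W₂) :
    ‖v‖ = Real.sqrt (∑ p, c₀ * ‖WL2.equiv ℂ _ W₂ v p‖ ^ 2) := by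
  rw [← WL2.norm_sq, Real.sqrt_sq (norm_nonneg _)]

/-- ★ **(FS) ON THE BOND GRAPH** (`d = 3`, unit mass, diagonal `c₀t³ = c₁`, `t ≤ P_ν`): for `ψ ≥ 0` on the bonds, `(L₀+1)φ₁ = ψ`, `(L₀+1)φ₂ = φ₁` with `L₀` the `t²`-weighted Laplacian of the
bond graph (neighbours `(y ∓ e_ν, μ)` — three decoupled copies of the site graph), `φ₂(p) ≤ √(3³∕c₁)·√(Σ_q c₀ψ(q)²)`: lit ✓`hFS_tsite_diag` on the component of `p`, then the component
sum is below the full sum. [cite: Balaban1984PropagatorsI, (1.29) p.23; Balaban1985BackgroundPropagators, (3.39) p.397] -/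
theorem hFS_bond (F : T3Family) (K : ℕ) {t c₀ c₁ : ℝ} (ht : 0 < t) (hc₀ : 0 < c₀) (hc₁ : c₀ * t ^ 3 = c₁) (hvol : ∀ ν, t ≤ ((periodsT3 F K ν : ℕ) : ℝ)) :
    ∀ ψ φ₁ φ₂ : Bond 3 (periodsT3 F K) → ℝ, (∀ p, 0 ≤ ψ p) →
      (∀ p, ∑ j : Fin 3 ⊕ Fin 3, t ^ 2 * (φ₁ p - φ₁ (Sum.elim (fun ν => unshift ν p.1) (fun ν => shift ν p.1) j, p.2)) + 1 * φ₁ p = ψ p) →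
      (∀ p, ∑ j : Fin 3 ⊕ Fin 3, t ^ 2 * (φ₂ p - φ₂ (Sum.elim (fun ν => unshift ν p.1) (fun ν => shift ν p.1) j, p.2)) + 1 * φ₂ p = φ₁ p) →
      ∀ p, φ₂ p ≤ Real.sqrt (3 ^ 3 / c₁) * Real.sqrt (∑ q, (fun _ : Bond 3 (periodsT3 F K) => c₀) q * ψ q ^ 2) := by
  intro ψ φ₁ φ₂ hψ h₁ h₂ p
  obtain ⟨y, μ⟩ := p
  -- the resolvent equations restricted to the component `μ` are lit's site equations
  have hcomp : ∀ (φ χ : Bond 3 (periodsT3 F K) → ℝ),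
      (∀ p, ∑ j : Fin 3 ⊕ Fin 3, t ^ 2 * (φ p - φ (Sum.elim (fun ν => unshift ν p.1) (fun ν => shift ν p.1) j, p.2)) + 1 * φ p = χ p) →
      ∀ z, ∑ j : Fin 3 ⊕ Fin 3, t ^ 2 * ((fun z => φ (z, μ)) z - (fun z => φ (z, μ)) (Sum.elim (fun ν => unshift ν z) (fun ν => shift ν z) j))
          + 1 * (fun z => φ (z, μ)) z = (fun z => χ (z, μ)) z := by
    intro φ χ hφ z
    have e := hφ (z, μ)
    dsimp only at e ⊢
    exact e
  have hS := hFS_tsite_diag (periodsT3 F K) (d := 3) (by norm_num) ht hc₀ hc₁ hvol (fun z => ψ (z, μ)) (fun z => φ₁ (z, μ)) (fun z => φ₂ (z, μ))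
    (fun z => hψ _) (hcomp φ₁ ψ h₁) (hcomp φ₂ φ₁ h₂) y
  -- the component sum is below the full sum
  refine hS.trans (mul_le_mul_of_nonneg_left (Real.sqrt_le_sqrt ?_) (Real.sqrt_nonneg _))
  rw [Fintype.sum_prod_type]
  refine Finset.sum_le_sum fun z _ => ?_
  have hz : c₀ * ψ (z, μ) ^ 2 = ∑ ν ∈ ({μ} : Finset (Fin 3)), c₀ * ψ (z, ν) ^ 2 := by rw [Finset.sum_singleton]
  simp only
  rw [hz]
  exact Finset.sum_le_sum_of_subset_of_nonneg (Finset.subset_univ _) fun ν _ _ => by positivity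

/-! ## §2 The bootstrap at the member's one-form operator -/

variable [Fact (0 < c₀)] {h : n ≤ K} {cB a : ℝ} [Fact (0 < cB)]
  {Δx : GaugeField (F.P K) 0 (Matrix.specialUnitaryGroup (Fin 2) ℂ) → (BondL2K ℂ 3 (periodsT3 F K) c₀ W₂ →ₗ[ℂ] BondL2K ℂ 3 (periodsT3 F K) c₀ W₂)}

/-- ★★★ **THE KATO BOOTSTRAP FOR `Δ_a = Δx + D R_S D* + Q*aQ` AT THE T³ MEMBER, ON THE BOND GRAPH.**  Let `U₀ ∈ RegPr F n K ε₀` with `2·(32√2·ε₀) < 1`, ANY slot `Δx`, and `u f` vector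
fields with `Δ_a(U₀)u = f`.  If at every bond `‖f(p)‖ ≤ F_b`, (X) `‖((Δx U₀ − Δ^η_{U₀})u)(p)‖ ≤ R_X`, (D) `‖(D_{U₀}(1 − R_S)D*_{U₀}u)(p)‖ ≤ R_D` and (Q) `‖(Q_k†(aQ_k u))(p)‖ ≤ R_Q`, then at
EVERY bond `‖u(p)‖ ≤ (2(F_b + (R_Q + R_D + R_X)) + √(3³∕(c₀ℓ³))·‖u‖) ∕ (1 − 2·(32√2·ε₀))` — lit ✓`norm_le_of_kato_bootstrap_linf` at O1's reading (✓`symm_laplaceA_toL2_apply` + ★px16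
✓`covLapFormT_one_eq` + `kato_sum_eq_vecLap`; unit mass, weights `ℓ²`, isometric transporters), `p_∞ := 32√2·ε₀` (✓`norm_local_remainder_le_of_regPr` at `s := sup‖u‖`, `√2` Frobenius∕operator),
(FS) := `hFS_bond`.  CONDITIONAL on (X)(D)(Q). [cite: Balaban1985BackgroundPropagators, Thm 3.1 (3.42) p.397, (3.39) p.397, Thm 3.12 p.422, p.421; Balaban1985Variational, (134)–(136) p.298] -/
theorem norm_apply_le_of_kato_oneForm (hnK : n ≤ K) {ε₀ : ℝ} (U₀ : GaugeField (F.P K) 0 (Matrix.specialUnitaryGroup (Fin 2) ℂ)) (hreg : RegPr F n K ε₀ U₀)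
    (hε₀ : 2 * (32 * Real.sqrt 2 * ε₀) < 1)
    {u f : BondL2K ℂ 3 (periodsT3 F K) c₀ W₂} (hu : laplaceA F n K h c₀ cB a Δx U₀ u = f)
    {Fb RX RD RQ : ℝ} (hF : ∀ p, ‖WL2.equiv ℂ _ W₂ f p‖ ≤ Fb)
    (hRX : ∀ p, ‖WL2.equiv ℂ _ W₂ ((Δx U₀ - (DeltaEta F n K c₀ U₀ : BondL2K ℂ 3 (periodsT3 F K) c₀ W₂ →ₗ[ℂ] BondL2K ℂ 3 (periodsT3 F K) c₀ W₂)) u) p‖ ≤ RX)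
    (hRD : ∀ p, ‖WL2.equiv ℂ _ W₂ (DL2 F n K c₀ U₀ (DstarL2 F n K c₀ U₀ u - RS F n K h c₀ cB U₀ (DstarL2 F n K c₀ U₀ u))) p‖ ≤ RD)
    (hRQ : ∀ p, ‖WL2.equiv ℂ _ W₂ (LinearMap.adjoint (Qk F n K h c₀ cB U₀) (((a : ℝ) : ℂ) • Qk F n K h c₀ cB U₀ u)) p‖ ≤ RQ)
    (p : Bond 3 (periodsT3 F K)) :
    ‖WL2.equiv ℂ _ W₂ u p‖
      ≤ (2 * (Fb + (RQ + RD + RX)) + Real.sqrt (3 ^ 3 / (c₀ * ((F.L : ℝ) ^ (K - n)) ^ 3)) * ‖u‖) / (1 - 2 * (32 * Real.sqrt 2 * ε₀)) := by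
  have hc₀ : 0 < c₀ := Fact.out
  -- the difference quotient `t = η⁻¹ = ℓ`
  set t : ℝ := (eta F n K)⁻¹ with ht_def
  have ht : 0 < t := inv_pos.mpr (eta_pos F n K)
  have htL : t = (F.L : ℝ) ^ (K - n) := by rw [ht_def, eta, inv_pow, inv_inv]
  -- the route reading of `u` and of every `L²` vector at a bond
  set X : PBond (F.P K) 0 → Matrix (Fin 2) (Fin 2) ℂ := (toL2 F K c₀).symm u with hX
  have huX : u = toL2 F K c₀ X := by rw [hX, LinearEquiv.apply_symm_apply]
  have hread : ∀ (g : BondL2K ℂ 3 (periodsT3 F K) c₀ W₂) (y : TSite 3 (periodsT3 F K)) (μ : Fin 3),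
      frobEquiv (WL2.equiv ℂ _ W₂ g (y, μ)) = (toL2 F K c₀).symm g ⟨(siteEquiv F K).symm y, μ⟩ := fun g y μ => by
    rw [toL2_symm_apply, bondEquiv_apply, Equiv.apply_symm_apply]; rfl
  -- abstract data of the bootstrap on the bond graph
  let nbr : Bond 3 (periodsT3 F K) → Fin 3 ⊕ Fin 3 → Bond 3 (periodsT3 F K) :=
    fun q j => (Sum.elim (fun ν => unshift ν q.1) (fun ν => shift ν q.1) j, q.2)
  let T : Bond 3 (periodsT3 F K) → Fin 3 ⊕ Fin 3 → W₂ →ₗ[ℂ] W₂ :=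
    fun q j => Sum.elim (fun ν => adBgInv F K U₀ (unshift ν q.1, ν)) (fun ν => adBg F K U₀ (q.1, ν)) j
  have hT : ∀ q j w, ‖T q j w‖ ≤ ‖w‖ := fun q j w => by
    rcases j with ν | ν
    · exact (norm_adBgInv_eq F K U₀ _ w).le
    · exact (norm_adBg_eq F K U₀ _ w).le
  -- the remainder `q = aQ*Qu − D(1−R_S)D*u + (Δx − Δ^η)u + η⁻²(Δ′₁ − 𝒦)u`
  let qf : Bond 3 (periodsT3 F K) → W₂ := fun q =>
    WL2.equiv ℂ _ W₂ (LinearMap.adjoint (Qk F n K h c₀ cB U₀) (((a : ℝ) : ℂ) • Qk F n K h c₀ cB U₀ u)) q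
      - WL2.equiv ℂ _ W₂ (DL2 F n K c₀ U₀ (DstarL2 F n K c₀ U₀ u - RS F n K h c₀ cB U₀ (DstarL2 F n K c₀ U₀ u))) q
      + WL2.equiv ℂ _ W₂ ((Δx U₀ - (DeltaEta F n K c₀ U₀ : BondL2K ℂ 3 (periodsT3 F K) c₀ W₂ →ₗ[ℂ] BondL2K ℂ 3 (periodsT3 F K) c₀ W₂)) u) q
      + frobEquiv.symm ((eta F n K)⁻¹ • (eta F n K)⁻¹ •
          (deltaPrimeOp (torusT (F.P K) 0) (fun ν x => bgUnits F K U₀ ⟨x, ν⟩) 1 (formComp X) q.2 ((siteEquiv F K).symm q.1)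
            - curvOp (torusT (F.P K) 0) (fun ν x => bgUnits F K U₀ ⟨x, ν⟩) (formComp X) q.2 ((siteEquiv F K).symm q.1)))
  -- O1: the Kato form `Σ_j t²•(u − T u(nbr)) = f − q`
  have hu' : ∀ q, ∑ j, ((t ^ 2 : ℝ) : ℂ) • (WL2.equiv ℂ _ W₂ u q - T q j (WL2.equiv ℂ _ W₂ u (nbr q j))) = WL2.equiv ℂ _ W₂ f q - qf q := by
    rintro ⟨y, μ⟩
    have hk := kato_sum_eq_vecLap (c₀ := c₀) U₀ u t y μ
    rw [hk]
    apply frobEquiv.injective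
    rw [LinearEquiv.apply_symm_apply, map_sub, hread f, ← hu, huX, symm_laplaceA_toL2_apply, covLapFormT_one_eq]
    simp only [qf, map_add, map_sub, hread, huX, LinearEquiv.apply_symm_apply, LinearEquiv.symm_apply_apply]
    -- the scalar `t² = η⁻¹·η⁻¹` (complex vs real action)
    have hsc : (((t ^ 2 : ℝ) : ℂ)) • vecLap (torusT (F.P K) 0) (fun ν x => bgUnits F K U₀ ⟨x, ν⟩) (formComp X) μ ((siteEquiv F K).symm y)
        = (eta F n K)⁻¹ • (eta F n K)⁻¹ • vecLap (torusT (F.P K) 0) (fun ν x => bgUnits F K U₀ ⟨x, ν⟩) (formComp X) μ ((siteEquiv F K).symm y) := by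
      rw [Complex.coe_smul, smul_smul, ht_def, sq]
    rw [hsc]
    abel
  -- (FS) on the bond graph, unit mass, `C₃ = √(3³∕(c₀t³))`
  have hvol : ∀ ν, t ≤ ((periodsT3 F K ν : ℕ) : ℝ) := fun ν => eta_inv_le_periods F n K hnK ν
  have hFS := hFS_bond F K ht hc₀ (c₁ := c₀ * t ^ 3) rfl hvol
  -- the `p_∞` letter: `‖q(p)‖ ≤ 32√2ε₀·sup‖u‖ + (R_Q + R_D + R_X)`
  haveI : Nonempty (Bond 3 (periodsT3 F K)) := ⟨p⟩
  have hbdd : BddAbove (Set.range fun q => ‖WL2.equiv ℂ _ W₂ u q‖) := (Set.finite_range _).bddAbove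
  have hsup : ∀ q, ‖WL2.equiv ℂ _ W₂ u q‖ ≤ ⨆ q', ‖WL2.equiv ℂ _ W₂ u q'‖ := fun q => le_ciSup hbdd q
  have hXs : ∀ b, ‖X b‖ ≤ ⨆ q', ‖WL2.equiv ℂ _ W₂ u q'‖ := fun b => by
    rw [hX, toL2_symm_apply]; exact (norm_frobEquiv_le _).trans (hsup _)
  have hq : ∀ q, ‖qf q‖ ≤ 32 * Real.sqrt 2 * ε₀ * (⨆ q', ‖WL2.equiv ℂ _ W₂ u q'‖) + (RQ + RD + RX) := by
    rintro ⟨y, μ⟩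
    have hloc := norm_local_remainder_le_of_regPr F U₀ hreg hXs ⟨(siteEquiv F K).symm y, μ⟩
    have hloc' : ‖(frobEquiv.symm ((eta F n K)⁻¹ • (eta F n K)⁻¹ •
        (deltaPrimeOp (torusT (F.P K) 0) (fun ν x => bgUnits F K U₀ ⟨x, ν⟩) 1 (formComp X) μ ((siteEquiv F K).symm y)
          - curvOp (torusT (F.P K) 0) (fun ν x => bgUnits F K U₀ ⟨x, ν⟩) (formComp X) μ ((siteEquiv F K).symm y))) : W₂)‖
        ≤ 32 * Real.sqrt 2 * ε₀ * (⨆ q', ‖WL2.equiv ℂ _ W₂ u q'‖) := by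
      refine (norm_frobEquiv_symm_le _).trans ?_
      have h2 : 0 ≤ Real.sqrt 2 := Real.sqrt_nonneg _
      nlinarith [hloc, h2]
    calc ‖qf (y, μ)‖
        ≤ ‖WL2.equiv ℂ _ W₂ (LinearMap.adjoint (Qk F n K h c₀ cB U₀) (((a : ℝ) : ℂ) • Qk F n K h c₀ cB U₀ u)) (y, μ)
              - WL2.equiv ℂ _ W₂ (DL2 F n K c₀ U₀ (DstarL2 F n K c₀ U₀ u - RS F n K h c₀ cB U₀ (DstarL2 F n K c₀ U₀ u))) (y, μ)
              + WL2.equiv ℂ _ W₂ ((Δx U₀ - (DeltaEta F n K c₀ U₀ : BondL2K ℂ 3 (periodsT3 F K) c₀ W₂ →ₗ[ℂ] BondL2K ℂ 3 (periodsT3 F K) c₀ W₂)) u) (y, μ)‖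
            + ‖(frobEquiv.symm ((eta F n K)⁻¹ • (eta F n K)⁻¹ •
                (deltaPrimeOp (torusT (F.P K) 0) (fun ν x => bgUnits F K U₀ ⟨x, ν⟩) 1 (formComp X) μ ((siteEquiv F K).symm y)
                  - curvOp (torusT (F.P K) 0) (fun ν x => bgUnits F K U₀ ⟨x, ν⟩) (formComp X) μ ((siteEquiv F K).symm y))) : W₂)‖ :=
          norm_add_le _ _
      _ ≤ (RQ + RD + RX) + 32 * Real.sqrt 2 * ε₀ * (⨆ q', ‖WL2.equiv ℂ _ W₂ u q'‖) :=
          add_le_add ((norm_add_le _ _).trans (add_le_add ((norm_sub_le _ _).trans (add_le_add (hRQ _) (hRD _))) (hRX _))) hloc'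
      _ = _ := add_comm _ _
  -- the engine (lit ✓`norm_le_of_kato_bootstrap`, Kato domination twice) at the displayed number `Pq := p_∞·sup‖u‖ + R`, at every bond …
  set Su : ℝ := ⨆ q', ‖WL2.equiv ℂ _ W₂ u q'‖ with hSu
  have key : ∀ q, ‖WL2.equiv ℂ _ W₂ u q‖ ≤ 2 * (Fb + (32 * Real.sqrt 2 * ε₀ * Su + (RQ + RD + RX))) / 1
      + 1 ^ 2 * Real.sqrt (3 ^ 3 / (c₀ * t ^ 3)) * Real.sqrt (∑ q', c₀ * ‖WL2.equiv ℂ _ W₂ u q'‖ ^ 2) := fun q =>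
    norm_le_of_kato_bootstrap (𝕜 := ℂ) nbr (fun _ _ => t ^ 2) (fun _ _ => sq_nonneg _) T hT (fun _ => c₀) (m := 1) one_pos hFS hu' hF hq q
  -- … hence at the sup, which is solved for it (the rearrangement of lit ✓`norm_le_of_kato_bootstrap_linf`)
  have hSle : Su ≤ 2 * (Fb + (32 * Real.sqrt 2 * ε₀ * Su + (RQ + RD + RX))) / 1
      + 1 ^ 2 * Real.sqrt (3 ^ 3 / (c₀ * t ^ 3)) * Real.sqrt (∑ q', c₀ * ‖WL2.equiv ℂ _ W₂ u q'‖ ^ 2) := ciSup_le key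
  rw [← norm_eq_sqrt_sum_bond, htL] at hSle
  have hden : 0 < 1 - 2 * (32 * Real.sqrt 2 * ε₀) := by linarith
  have e : 2 * (Fb + (32 * Real.sqrt 2 * ε₀ * Su + (RQ + RD + RX))) / 1
        + 1 ^ 2 * Real.sqrt (3 ^ 3 / (c₀ * ((F.L : ℝ) ^ (K - n)) ^ 3)) * ‖u‖
      = (2 * (Fb + (RQ + RD + RX)) + Real.sqrt (3 ^ 3 / (c₀ * ((F.L : ℝ) ^ (K - n)) ^ 3)) * ‖u‖) + (2 * (32 * Real.sqrt 2 * ε₀)) * Su := by ring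
  rw [e] at hSle
  have hsolve : Su ≤ (2 * (Fb + (RQ + RD + RX)) + Real.sqrt (3 ^ 3 / (c₀ * ((F.L : ℝ) ^ (K - n)) ^ 3)) * ‖u‖) / (1 - 2 * (32 * Real.sqrt 2 * ε₀)) := by
    rw [le_div_iff₀ hden]
    have e2 : Su * (1 - 2 * (32 * Real.sqrt 2 * ε₀)) = Su - (2 * (32 * Real.sqrt 2 * ε₀)) * Su := by ring
    rw [e2]
    linarith
  exact (hsup p).trans hsolve

/-! ## §3 With the energy, penalty and support letters: print's «|G(U)f| ≤ B₀|f|» for block-supported data -/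

/-- ★★ **THE ONE-FORM VALUE ROW FOR BLOCK-SUPPORTED DATA, ANY SLOT.**  In the situation of `norm_apply_le_of_kato_oneForm`, assume moreover `200·ε₀ ≤ 1`, the ENERGY letter
(E) `‖u‖ ≤ C_E‖f‖` (coercivity of `Δ_a`, `C_E = 1∕γ`), `R_Q ≤ p_Q‖u‖`, `R_D ≤ p_D‖u‖`, `R_X ≤ p_X‖u‖`, and that `f` vanishes off a finite set `S` of bonds.  Then at every bond
`‖u(p)‖ ≤ 2·(2 + (2(p_Q + p_D + p_X) + √(3³∕(c₀ℓ³)))·C_E·√(c₀·#S))·F_b` — for ONE BLOCK of bonds (`#S = 3ℓ³`) the scalar part `√(c₀·3ℓ³)·√(27∕(c₀ℓ³)) = 9` is K-FREE.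
CONDITIONAL on (E)(X)(D)(Q). [cite: Balaban1985BackgroundPropagators, Thm 3.1 (3.42) p.397 («supp λ ⊂ Δ(y′)»), Thm 3.12 p.422, (3.11) p.392] -/
theorem norm_apply_le_of_kato_oneForm_block (hnK : n ≤ K) {ε₀ : ℝ} (U₀ : GaugeField (F.P K) 0 (Matrix.specialUnitaryGroup (Fin 2) ℂ)) (hreg : RegPr F n K ε₀ U₀)
    (hε₀ : 200 * ε₀ ≤ 1)
    {u f : BondL2K ℂ 3 (periodsT3 F K) c₀ W₂} (hu : laplaceA F n K h c₀ cB a Δx U₀ u = f)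
    (S : Finset (Bond 3 (periodsT3 F K))) (hfS : ∀ p, p ∉ S → WL2.equiv ℂ _ W₂ f p = 0)
    {Fb RX RD RQ CE pX pD pQ : ℝ} (hF : ∀ p, ‖WL2.equiv ℂ _ W₂ f p‖ ≤ Fb)
    (hRX : ∀ p, ‖WL2.equiv ℂ _ W₂ ((Δx U₀ - (DeltaEta F n K c₀ U₀ : BondL2K ℂ 3 (periodsT3 F K) c₀ W₂ →ₗ[ℂ] BondL2K ℂ 3 (periodsT3 F K) c₀ W₂)) u) p‖ ≤ RX)
    (hRD : ∀ p, ‖WL2.equiv ℂ _ W₂ (DL2 F n K c₀ U₀ (DstarL2 F n K c₀ U₀ u - RS F n K h c₀ cB U₀ (DstarL2 F n K c₀ U₀ u))) p‖ ≤ RD)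
    (hRQ : ∀ p, ‖WL2.equiv ℂ _ W₂ (LinearMap.adjoint (Qk F n K h c₀ cB U₀) (((a : ℝ) : ℂ) • Qk F n K h c₀ cB U₀ u)) p‖ ≤ RQ)
    (hpX : 0 ≤ pX) (hpD : 0 ≤ pD) (hpQ : 0 ≤ pQ) (hCE : 0 ≤ CE) (hE : ‖u‖ ≤ CE * ‖f‖)
    (hRX₂ : RX ≤ pX * ‖u‖) (hRD₂ : RD ≤ pD * ‖u‖) (hRQ₂ : RQ ≤ pQ * ‖u‖)
    (p : Bond 3 (periodsT3 F K)) :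
    ‖WL2.equiv ℂ _ W₂ u p‖
      ≤ 2 * ((2 + (2 * (pQ + pD + pX) + Real.sqrt (3 ^ 3 / (c₀ * ((F.L : ℝ) ^ (K - n)) ^ 3))) * CE * Real.sqrt (c₀ * S.card)) * Fb) := by
  have hc₀ : 0 < c₀ := Fact.out
  have hFb : 0 ≤ Fb := (norm_nonneg _).trans (hF p)
  have h2 : (0 : ℝ) < Real.sqrt 2 := Real.sqrt_pos.mpr two_pos
  have hs2 : Real.sqrt 2 < 1.5 := by
    rw [show (1.5 : ℝ) = Real.sqrt (1.5 ^ 2) by rw [Real.sqrt_sq (by norm_num)]]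
    exact Real.sqrt_lt_sqrt (by norm_num) (by norm_num)
  have hε : 0 ≤ ε₀ ∨ ε₀ < 0 := le_or_gt 0 ε₀
  have hε₀' : 2 * (32 * Real.sqrt 2 * ε₀) < 1 := by
    rcases hε with hε | hε <;> nlinarith
  have hden : 1 / 2 ≤ 1 - 2 * (32 * Real.sqrt 2 * ε₀) := by
    rcases hε with hε | hε <;> nlinarith
  -- `‖f‖ ≤ √(c₀·#S)·F_b`
  have hsupp : ‖f‖ ≤ Real.sqrt (c₀ * S.card) * Fb := by
    have hsq : ‖f‖ ^ 2 ≤ (Real.sqrt (c₀ * S.card) * Fb) ^ 2 := by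
      rw [WL2.norm_sq f, mul_pow, Real.sq_sqrt (by positivity)]
      have hsplit : ∑ q, c₀ * ‖WL2.equiv ℂ _ W₂ f q‖ ^ 2 = ∑ q ∈ S, c₀ * ‖WL2.equiv ℂ _ W₂ f q‖ ^ 2 := by
        rw [← Finset.sum_subset (Finset.subset_univ S)]
        intro q _ hq
        rw [hfS q hq, norm_zero]; ring
      rw [hsplit]
      calc ∑ q ∈ S, c₀ * ‖WL2.equiv ℂ _ W₂ f q‖ ^ 2 ≤ ∑ q ∈ S, c₀ * Fb ^ 2 := by
            refine Finset.sum_le_sum fun q _ => ?_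
            exact mul_le_mul_of_nonneg_left (pow_le_pow_left₀ (norm_nonneg _) (hF q) 2) hc₀.le
        _ = c₀ * S.card * Fb ^ 2 := by rw [Finset.sum_const, nsmul_eq_mul]; ring
    have h0 : 0 ≤ Real.sqrt (c₀ * S.card) * Fb := by positivity
    exact (pow_le_pow_iff_left₀ (norm_nonneg _) h0 two_ne_zero).mp hsq
  have h0 := norm_apply_le_of_kato_oneForm (h := h) (cB := cB) (a := a) (Δx := Δx) hnK U₀ hreg hε₀' hu hF hRX hRD hRQ p
  set C₃ := Real.sqrt (3 ^ 3 / (c₀ * ((F.L : ℝ) ^ (K - n)) ^ 3)) with hC₃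
  have hC₃0 : 0 ≤ C₃ := Real.sqrt_nonneg _
  have hNu : ‖u‖ ≤ CE * (Real.sqrt (c₀ * S.card) * Fb) := hE.trans (mul_le_mul_of_nonneg_left hsupp hCE)
  have hRQ' : RQ ≤ pQ * (CE * (Real.sqrt (c₀ * S.card) * Fb)) := hRQ₂.trans (mul_le_mul_of_nonneg_left hNu hpQ)
  have hRD' : RD ≤ pD * (CE * (Real.sqrt (c₀ * S.card) * Fb)) := hRD₂.trans (mul_le_mul_of_nonneg_left hNu hpD)
  have hRX' : RX ≤ pX * (CE * (Real.sqrt (c₀ * S.card) * Fb)) := hRX₂.trans (mul_le_mul_of_nonneg_left hNu hpX)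
  have hnum : 2 * (Fb + (RQ + RD + RX)) + C₃ * ‖u‖ ≤ (2 + (2 * (pQ + pD + pX) + C₃) * CE * Real.sqrt (c₀ * S.card)) * Fb := by
    have h3 : C₃ * ‖u‖ ≤ C₃ * (CE * (Real.sqrt (c₀ * S.card) * Fb)) := mul_le_mul_of_nonneg_left hNu hC₃0
    nlinarith
  have hnum0 : 0 ≤ 2 * (Fb + (RQ + RD + RX)) + C₃ * ‖u‖ := by
    have := (norm_nonneg _).trans (hRQ p); have := (norm_nonneg _).trans (hRD p); have := (norm_nonneg _).trans (hRX p); positivity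
  calc ‖WL2.equiv ℂ _ W₂ u p‖ ≤ (2 * (Fb + (RQ + RD + RX)) + C₃ * ‖u‖) / (1 - 2 * (32 * Real.sqrt 2 * ε₀)) := h0
    _ ≤ (2 * (Fb + (RQ + RD + RX)) + C₃ * ‖u‖) / (1 / 2) := div_le_div_of_nonneg_left hnum0 (by norm_num) hden
    _ = 2 * (2 * (Fb + (RQ + RD + RX)) + C₃ * ‖u‖) := by ring
    _ ≤ 2 * ((2 + (2 * (pQ + pD + pX) + C₃) * CE * Real.sqrt (c₀ * S.card)) * Fb) := by linarith

/-- ★★ **THE SLOT OF RECORD `Δx := Δ^η` (print's `G₀ = (Δ + DRD* + Q*aQ)⁻¹`, p. 421): the letter (X) vanishes identically**, so the block row reads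
`‖u(p)‖ ≤ 2·(2 + (2(p_Q + p_D) + √(3³∕(c₀ℓ³)))·C_E·√(c₀·#S))·F_b`.  CONDITIONAL on (E)(D)(Q). [cite: Balaban1985BackgroundPropagators, p.421, Thm 3.1 (3.42) p.397] -/
theorem norm_apply_le_of_kato_oneForm_block_DeltaEta (hnK : n ≤ K) {ε₀ : ℝ} (U₀ : GaugeField (F.P K) 0 (Matrix.specialUnitaryGroup (Fin 2) ℂ)) (hreg : RegPr F n K ε₀ U₀)
    (hε₀ : 200 * ε₀ ≤ 1)
    {u f : BondL2K ℂ 3 (periodsT3 F K) c₀ W₂} (hu : laplaceA F n K h c₀ cB a (DeltaEtaSlot F n K c₀) U₀ u = f)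
    (S : Finset (Bond 3 (periodsT3 F K))) (hfS : ∀ p, p ∉ S → WL2.equiv ℂ _ W₂ f p = 0)
    {Fb RD RQ CE pD pQ : ℝ} (hF : ∀ p, ‖WL2.equiv ℂ _ W₂ f p‖ ≤ Fb)
    (hRD : ∀ p, ‖WL2.equiv ℂ _ W₂ (DL2 F n K c₀ U₀ (DstarL2 F n K c₀ U₀ u - RS F n K h c₀ cB U₀ (DstarL2 F n K c₀ U₀ u))) p‖ ≤ RD)
    (hRQ : ∀ p, ‖WL2.equiv ℂ _ W₂ (LinearMap.adjoint (Qk F n K h c₀ cB U₀) (((a : ℝ) : ℂ) • Qk F n K h c₀ cB U₀ u)) p‖ ≤ RQ)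
    (hpD : 0 ≤ pD) (hpQ : 0 ≤ pQ) (hCE : 0 ≤ CE) (hE : ‖u‖ ≤ CE * ‖f‖) (hRD₂ : RD ≤ pD * ‖u‖) (hRQ₂ : RQ ≤ pQ * ‖u‖)
    (p : Bond 3 (periodsT3 F K)) :
    ‖WL2.equiv ℂ _ W₂ u p‖
      ≤ 2 * ((2 + (2 * (pQ + pD) + Real.sqrt (3 ^ 3 / (c₀ * ((F.L : ℝ) ^ (K - n)) ^ 3))) * CE * Real.sqrt (c₀ * S.card)) * Fb) := by
  have hX0 : ∀ q, ‖WL2.equiv ℂ _ W₂ ((DeltaEtaSlot F n K c₀ U₀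
      - (DeltaEta F n K c₀ U₀ : BondL2K ℂ 3 (periodsT3 F K) c₀ W₂ →ₗ[ℂ] BondL2K ℂ 3 (periodsT3 F K) c₀ W₂)) u) q‖ ≤ 0 := fun q => by
    have h0 : (DeltaEtaSlot F n K c₀ U₀ - (DeltaEta F n K c₀ U₀ : BondL2K ℂ 3 (periodsT3 F K) c₀ W₂ →ₗ[ℂ] BondL2K ℂ 3 (periodsT3 F K) c₀ W₂)) u = 0 := by
      rw [LinearMap.sub_apply, DeltaEtaSlot_apply, ContinuousLinearMap.coe_coe, sub_self]
    rw [h0, WL2.equiv_zero, Pi.zero_apply, norm_zero]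
  have h := norm_apply_le_of_kato_oneForm_block (h := h) (cB := cB) (a := a) (Δx := DeltaEtaSlot F n K c₀) hnK U₀ hreg hε₀ hu S hfS hF hX0 hRD hRQ
    le_rfl hpD hpQ hCE hE (by rw [zero_mul]) hRD₂ hRQ₂ p
  simpa only [add_zero] using h

end Summit.QuantumFields.YangMills.Theorems.Prop7OneFormKatoBootstrap

end
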